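import Mathlib
import HarnessLib
import Literature.Analysis.FluidPDE.NewtonPotentialHolder
import Literature.Analysis.FluidPDE.WeakSolution
import Summits.NavierStokesRegularity.NavierStokesRegularity.Theorems.ChiralWindowDoorDefs
import Summits.NavierStokesRegularity.NavierStokesRegularity.Theorems.CriticalFluxDoorDefs
import Summits.NavierStokesRegularity.NavierStokesRegularity.Theorems.RellichScarDefs
import Summits.NavierStokesRegularity.NavierStokesRegularity.Theorems.CriticalFluxDoorCommutatorPairing

/-!
# Door S21-C «CriticalFluxDoor» — the commutator pairing in KERNEL FORM (F3-DERIVATION §2 (c), time-ready):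
# `|∫⟪[Λ,a_R]v(t), ∂ₜv(t)⟫| ≤ c_A k_{3/4}(t) + c_B R²((R+√(−t))⁴)⁻¹ + c_C k_{1/2}(t)`

Door S21-C of nsreg-p1's local Type-I door family (`HOME/ns-regularity-ideate-p1/ROUND-20.md` §2b F3; DESIGN-ONLY,
route NOT born).  The two radial integrals of `…CriticalFluxDoorCommutatorPairing.abs_commutatorPairing_le` are
evaluated in the two regimes `−t ≤ R²` / `−t ≥ R²` (`σ = √(−t)`):
`∫_{B_{4R}}((‖x‖+σ)³)⁻¹ ≤ min(12|B₁|√R σ^{−1/2}, 64|B₁|R³σ⁻³)` (through `(‖x‖+σ)³ ≥ ‖x‖^{5/2}σ^{1/2}`) and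
`∫_{B_{4R}ᶜ}‖x‖⁻⁴((‖x‖+σ)³)⁻¹ ≤ min((3/1024)|B₁|R⁻⁴, (3/4)|B₁|R⁻¹σ⁻³)` (tree `NewtonPotentialHolder` radial integrals),
which puts the pairing under the two-regime kernels of `…CriticalFluxDoorTimeKernels` (`α = 3/4` near, `α = 1/2` far)
and the annulus kernel `R²((R+σ)⁴)⁻¹` of `…TimeIntegratedError` — all with time integrals independent of `R`.

* `radial_near_le_one`, `radial_near_le_two`, `radial_far_le_one`, `radial_far_le_two` — the four radial bounds;
* `near_term_one/two`, `annulus_term`, `far_term_one/two` — the five term estimates (real algebra);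
* `exists_commutatorKernel_bound` — **the kernel form of the commutator pairing.**

Seat nsreg-p6 g13 (THEOREMS-ONLY door sequels, DIRECTOR-NS g8 #32 (2)/#36).  WHAT THIS IS NOT: not NS regularity (Clay A);
flux bookkeeping; no route is opened.
-/

noncomputable section

-- the summit and its single sub-problem share the name (CONVENTIONS §1), as in every Theorems file
set_option linter.dupNamespace false

namespace Summit.NavierStokesRegularity.NavierStokesRegularity.Theorems.CriticalFluxDoorCommutatorKernel

open MeasureTheory Metric Set Filter Topology Function
open scoped RealInnerProductSpace
open Literature.Analysis Literature.Analysis.FluidPDE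
open Summit.NavierStokesRegularity.NavierStokesRegularity.Theorems.ChiralWindowDoorDefs
open Summit.NavierStokesRegularity.NavierStokesRegularity.Theorems.CriticalFluxDoorDefs
open Summit.NavierStokesRegularity.NavierStokesRegularity.Theorems.RellichScarScarRigidity (ScaleInvariantBounds)
open Summit.NavierStokesRegularity.NavierStokesRegularity.Theorems.CriticalFluxDoorCommutatorPairing
  (abs_commutatorPairing_le)

/-! ### The four radial bounds -/

/-- Near regime 2: `∫_{B_L}((‖x‖+σ)³)⁻¹ ≤ σ⁻³ · L³|B₁|`. -/
theorem radial_near_le_two {L σ : ℝ} (hL : 0 < L) (hσ : 0 < σ) :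
    ∫ x in ball (0 : EuclideanSpace ℝ (Fin 3)) L, ((‖x‖ + σ) ^ 3)⁻¹ ≤
      (σ ^ 3)⁻¹ * (L ^ 3 * (volume : Measure (EuclideanSpace ℝ (Fin 3))).real (ball 0 1)) := by
  have hc : Continuous fun x : EuclideanSpace ℝ (Fin 3) => ((‖x‖ + σ) ^ 3)⁻¹ :=
    Continuous.inv₀ (by fun_prop) fun x => by positivity
  have hpt : ∀ x : EuclideanSpace ℝ (Fin 3), ((‖x‖ + σ) ^ 3)⁻¹ ≤ (σ ^ 3)⁻¹ := fun x =>
    inv_anti₀ (by positivity) (pow_le_pow_left₀ hσ.le (by linarith [norm_nonneg x]) 3)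
  have hi : IntegrableOn (fun x : EuclideanSpace ℝ (Fin 3) => ((‖x‖ + σ) ^ 3)⁻¹) (ball 0 L) :=
    Measure.integrableOn_of_bounded (M := (σ ^ 3)⁻¹) measure_ball_lt_top.ne hc.aestronglyMeasurable
      (ae_of_all _ fun x => by rw [Real.norm_eq_abs, abs_of_nonneg (by positivity)]; exact hpt x)
  calc ∫ x in ball (0 : EuclideanSpace ℝ (Fin 3)) L, ((‖x‖ + σ) ^ 3)⁻¹
      ≤ ∫ x in ball (0 : EuclideanSpace ℝ (Fin 3)) L, (σ ^ 3)⁻¹ :=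
        setIntegral_mono_on hi (integrableOn_const measure_ball_lt_top.ne) measurableSet_ball fun x _ => hpt x
    _ = (volume : Measure (EuclideanSpace ℝ (Fin 3))).real (ball 0 L) * (σ ^ 3)⁻¹ := by
        rw [setIntegral_const, smul_eq_mul]
    _ ≤ (L ^ 3 * (volume : Measure (EuclideanSpace ℝ (Fin 3))).real (ball 0 1)) * (σ ^ 3)⁻¹ := by
        gcongr
        calc (volume : Measure (EuclideanSpace ℝ (Fin 3))).real (ball 0 L)
            ≤ (volume : Measure (EuclideanSpace ℝ (Fin 3))).real (closedBall 0 L) :=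
              measureReal_mono ball_subset_closedBall measure_closedBall_lt_top.ne
          _ = L ^ 3 * (volume : Measure (EuclideanSpace ℝ (Fin 3))).real (ball 0 1) := by
              rw [Measure.addHaar_real_closedBall volume (0 : EuclideanSpace ℝ (Fin 3)) hL.le, finrank_euclideanSpace_fin]
    _ = _ := mul_comm _ _

/-- Near regime 1: `∫_{B_L}((‖x‖+σ)³)⁻¹ ≤ (√σ)⁻¹ · 6|B₁|√L` (through `(‖x‖+σ)³ ≥ ‖x‖²√‖x‖·√σ`). -/
theorem radial_near_le_one {L σ : ℝ} (hL : 0 < L) (hσ : 0 < σ) :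
    ∫ x in ball (0 : EuclideanSpace ℝ (Fin 3)) L, ((‖x‖ + σ) ^ 3)⁻¹ ≤
      (Real.sqrt σ)⁻¹ * (6 * (volume : Measure (EuclideanSpace ℝ (Fin 3))).real (ball 0 1) * Real.sqrt L) := by
  set V₁ : ℝ := (volume : Measure (EuclideanSpace ℝ (Fin 3))).real (ball 0 1) with hV₁
  have hc : Continuous fun x : EuclideanSpace ℝ (Fin 3) => ((‖x‖ + σ) ^ 3)⁻¹ :=
    Continuous.inv₀ (by fun_prop) fun x => by positivity
  have hi : IntegrableOn (fun x : EuclideanSpace ℝ (Fin 3) => ((‖x‖ + σ) ^ 3)⁻¹) (ball 0 L) :=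
    Measure.integrableOn_of_bounded (M := (σ ^ 3)⁻¹) measure_ball_lt_top.ne hc.aestronglyMeasurable
      (ae_of_all _ fun x => by
        rw [Real.norm_eq_abs, abs_of_nonneg (by positivity)]
        exact inv_anti₀ (by positivity) (pow_le_pow_left₀ hσ.le (by linarith [norm_nonneg x]) 3))
  have hrad := NewtonPotentialHolder.integral_ball_norm_rpow_neg (s := 5 / 2) (by norm_num) hL
  have hradi := NewtonPotentialHolder.integrableOn_ball_norm_rpow_neg (s := 5 / 2) (by norm_num) L
  -- pointwise, off the origin: `((‖x‖+σ)³)⁻¹ ≤ (√σ)⁻¹ ‖x‖^{-5/2}`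
  have h0 : ∀ᵐ x ∂(volume : Measure (EuclideanSpace ℝ (Fin 3))), x ≠ 0 := by rw [ae_iff]; simp
  have hpt : ∀ᵐ x ∂(volume.restrict (ball (0 : EuclideanSpace ℝ (Fin 3)) L)),
      ((‖x‖ + σ) ^ 3)⁻¹ ≤ (Real.sqrt σ)⁻¹ * ‖x‖ ^ (-(5 / 2 : ℝ)) := by
    refine ae_restrict_of_ae ?_
    filter_upwards [h0] with x hx
    have hxpos : 0 < ‖x‖ := norm_pos_iff.2 hx
    have hsum : 0 < ‖x‖ + σ := by positivity
    -- `‖x‖^{5/2} √σ ≤ (‖x‖+σ)^{5/2} (‖x‖+σ)^{1/2} = (‖x‖+σ)³`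
    have h1 : ‖x‖ ^ (5 / 2 : ℝ) ≤ (‖x‖ + σ) ^ (5 / 2 : ℝ) :=
      Real.rpow_le_rpow (norm_nonneg _) (by linarith) (by norm_num)
    have h2 : Real.sqrt σ ≤ (‖x‖ + σ) ^ (1 / 2 : ℝ) := by
      rw [Real.sqrt_eq_rpow]; exact Real.rpow_le_rpow hσ.le (by linarith) (by norm_num)
    have h3 : (‖x‖ + σ) ^ (5 / 2 : ℝ) * (‖x‖ + σ) ^ (1 / 2 : ℝ) = (‖x‖ + σ) ^ 3 := by
      rw [← Real.rpow_add hsum, show (5 / 2 : ℝ) + 1 / 2 = (3 : ℕ) by norm_num, Real.rpow_natCast]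
    have hprod : ‖x‖ ^ (5 / 2 : ℝ) * Real.sqrt σ ≤ (‖x‖ + σ) ^ 3 := by
      rw [← h3]; exact mul_le_mul h1 h2 (Real.sqrt_nonneg _) (by positivity)
    have hxr : 0 < ‖x‖ ^ (5 / 2 : ℝ) := Real.rpow_pos_of_pos hxpos _
    rw [Real.rpow_neg (norm_nonneg _), ← mul_inv, mul_comm (Real.sqrt σ)]
    exact inv_anti₀ (by positivity) hprod
  calc ∫ x in ball (0 : EuclideanSpace ℝ (Fin 3)) L, ((‖x‖ + σ) ^ 3)⁻¹
      ≤ ∫ x in ball (0 : EuclideanSpace ℝ (Fin 3)) L, (Real.sqrt σ)⁻¹ * ‖x‖ ^ (-(5 / 2 : ℝ)) :=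
        integral_mono_ae hi (hradi.const_mul _) hpt
    _ = (Real.sqrt σ)⁻¹ * (3 * V₁ * (L ^ (3 - 5 / 2 : ℝ) / (3 - 5 / 2))) := by rw [integral_const_mul, hrad]
    _ = (Real.sqrt σ)⁻¹ * (6 * V₁ * Real.sqrt L) := by
        rw [show (3 : ℝ) - 5 / 2 = 1 / 2 by norm_num, ← Real.sqrt_eq_rpow]; ring

/-- Far regime 1: `∫_{B_L^c}(‖x‖⁴)⁻¹((‖x‖+σ)³)⁻¹ ≤ (3/4)|B₁| L⁻⁴` (through `(‖x‖+σ)³ ≥ ‖x‖³`), with integrability. -/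
theorem radial_far_le_one {L σ : ℝ} (hL : 0 < L) (hσ : 0 < σ) :
    IntegrableOn (fun x : EuclideanSpace ℝ (Fin 3) => (‖x‖ ^ 4)⁻¹ * ((‖x‖ + σ) ^ 3)⁻¹) (ball 0 L)ᶜ ∧
      ∫ x in (ball (0 : EuclideanSpace ℝ (Fin 3)) L)ᶜ, (‖x‖ ^ 4)⁻¹ * ((‖x‖ + σ) ^ 3)⁻¹ ≤
        3 * (volume : Measure (EuclideanSpace ℝ (Fin 3))).real (ball 0 1) * (L ^ 4)⁻¹ / 4 := by
  have h7 := NewtonPotentialHolder.integrableOn_compl_ball_norm_rpow_neg (t := 7) (by norm_num) hL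
  have h7v := NewtonPotentialHolder.integral_compl_ball_norm_rpow_neg (t := 7) (by norm_num) hL
  have hc3 : Continuous fun x : EuclideanSpace ℝ (Fin 3) => ((‖x‖ + σ) ^ 3)⁻¹ :=
    Continuous.inv₀ (by fun_prop) fun x => by positivity
  have hmeas : AEStronglyMeasurable (fun x : EuclideanSpace ℝ (Fin 3) => (‖x‖ ^ 4)⁻¹ * ((‖x‖ + σ) ^ 3)⁻¹)
      (volume.restrict (ball (0 : EuclideanSpace ℝ (Fin 3)) L)ᶜ) :=
    (((continuous_norm.measurable.pow_const 4).inv).mul hc3.measurable).aestronglyMeasurable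
  have hpt : ∀ x ∈ (ball (0 : EuclideanSpace ℝ (Fin 3)) L)ᶜ, (‖x‖ ^ 4)⁻¹ * ((‖x‖ + σ) ^ 3)⁻¹ ≤ ‖x‖ ^ (-(7 : ℝ)) := by
    intro x hx
    have hx' : L ≤ ‖x‖ := by simpa [mem_ball, dist_zero_right] using hx
    have hxpos : 0 < ‖x‖ := hL.trans_le hx'
    rw [Real.rpow_neg hxpos.le, show (7 : ℝ) = ((7 : ℕ) : ℝ) by norm_num, Real.rpow_natCast, ← mul_inv,
      show ‖x‖ ^ 7 = ‖x‖ ^ 4 * ‖x‖ ^ 3 by ring]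
    exact inv_anti₀ (by positivity)
      (mul_le_mul_of_nonneg_left (pow_le_pow_left₀ hxpos.le (by linarith) 3) (by positivity))
  have hi : IntegrableOn (fun x : EuclideanSpace ℝ (Fin 3) => (‖x‖ ^ 4)⁻¹ * ((‖x‖ + σ) ^ 3)⁻¹) (ball 0 L)ᶜ :=
    Integrable.mono' h7 hmeas ((ae_restrict_iff' measurableSet_ball.compl).2 (ae_of_all _ fun x hx => by
      rw [Real.norm_eq_abs, abs_of_nonneg (by positivity)]; exact hpt x hx))
  refine ⟨hi, ?_⟩
  calc ∫ x in (ball (0 : EuclideanSpace ℝ (Fin 3)) L)ᶜ, (‖x‖ ^ 4)⁻¹ * ((‖x‖ + σ) ^ 3)⁻¹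
      ≤ ∫ x in (ball (0 : EuclideanSpace ℝ (Fin 3)) L)ᶜ, ‖x‖ ^ (-(7 : ℝ)) :=
        setIntegral_mono_on hi h7 measurableSet_ball.compl hpt
    _ = 3 * (volume : Measure (EuclideanSpace ℝ (Fin 3))).real (ball 0 1) * (L ^ (3 - 7 : ℝ) / (7 - 3)) := h7v
    _ = 3 * (volume : Measure (EuclideanSpace ℝ (Fin 3))).real (ball 0 1) * (L ^ 4)⁻¹ / 4 := by
        rw [show (3 : ℝ) - 7 = -((4 : ℕ) : ℝ) by norm_num, Real.rpow_neg hL.le, Real.rpow_natCast]; ring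

/-- Far regime 2: `∫_{B_L^c}(‖x‖⁴)⁻¹((‖x‖+σ)³)⁻¹ ≤ σ⁻³ · 3|B₁| L⁻¹` (through `(‖x‖+σ)³ ≥ σ³`). -/
theorem radial_far_le_two {L σ : ℝ} (hL : 0 < L) (hσ : 0 < σ) :
    ∫ x in (ball (0 : EuclideanSpace ℝ (Fin 3)) L)ᶜ, (‖x‖ ^ 4)⁻¹ * ((‖x‖ + σ) ^ 3)⁻¹ ≤
      (σ ^ 3)⁻¹ * (3 * (volume : Measure (EuclideanSpace ℝ (Fin 3))).real (ball 0 1) * L⁻¹) := by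
  obtain ⟨hi, -⟩ := radial_far_le_one hL hσ
  have h4 := NewtonPotentialHolder.integrableOn_compl_ball_norm_rpow_neg (t := 4) (by norm_num) hL
  have h4v := NewtonPotentialHolder.integral_compl_ball_norm_rpow_neg (t := 4) (by norm_num) hL
  have hpt : ∀ x ∈ (ball (0 : EuclideanSpace ℝ (Fin 3)) L)ᶜ,
      (‖x‖ ^ 4)⁻¹ * ((‖x‖ + σ) ^ 3)⁻¹ ≤ (σ ^ 3)⁻¹ * ‖x‖ ^ (-(4 : ℝ)) := by
    intro x hx
    have hx' : L ≤ ‖x‖ := by simpa [mem_ball, dist_zero_right] using hx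
    have hxpos : 0 < ‖x‖ := hL.trans_le hx'
    rw [Real.rpow_neg hxpos.le, show (4 : ℝ) = ((4 : ℕ) : ℝ) by norm_num, Real.rpow_natCast,
      mul_comm ((σ ^ 3)⁻¹)]
    have hle : σ ^ 3 ≤ (‖x‖ + σ) ^ 3 := pow_le_pow_left₀ hσ.le (by linarith [norm_nonneg x]) 3
    exact mul_le_mul_of_nonneg_left (inv_anti₀ (by positivity) hle) (by positivity)
  calc ∫ x in (ball (0 : EuclideanSpace ℝ (Fin 3)) L)ᶜ, (‖x‖ ^ 4)⁻¹ * ((‖x‖ + σ) ^ 3)⁻¹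
      ≤ ∫ x in (ball (0 : EuclideanSpace ℝ (Fin 3)) L)ᶜ, (σ ^ 3)⁻¹ * ‖x‖ ^ (-(4 : ℝ)) :=
        setIntegral_mono_on hi (h4.const_mul _) measurableSet_ball.compl hpt
    _ = (σ ^ 3)⁻¹ * (3 * (volume : Measure (EuclideanSpace ℝ (Fin 3))).real (ball 0 1) * (L ^ (3 - 4 : ℝ) / (4 - 3))) := by
        rw [integral_const_mul, h4v]
    _ = (σ ^ 3)⁻¹ * (3 * (volume : Measure (EuclideanSpace ℝ (Fin 3))).real (ball 0 1) * L⁻¹) := by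
        rw [show (3 : ℝ) - 4 = -1 by norm_num, Real.rpow_neg_one]; ring

/-! ### Kernel algebra -/

/-- `√s`-powers as real powers: `(√R/R) (√s)⁻¹ (√(√s))⁻¹ = R^{2·(3/4)−2} s^{−3/4}`, `(R √s)⁻¹ = R^{2·(1/2)−2} s^{−1/2}`,
`R² ((√s)⁴)⁻¹ = R² s^{−2}` (`R, s > 0`). -/
theorem kernel_identities {R s : ℝ} (hR : 0 < R) (hs : 0 < s) :
    Real.sqrt R / R * ((Real.sqrt s)⁻¹ * (Real.sqrt (Real.sqrt s))⁻¹) = R ^ (2 * (3 / 4 : ℝ) - 2) * s ^ (-(3 / 4 : ℝ)) ∧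
      (R * Real.sqrt s)⁻¹ = R ^ (2 * (1 / 2 : ℝ) - 2) * s ^ (-(1 / 2 : ℝ)) ∧
      R ^ 2 * (Real.sqrt s ^ 4)⁻¹ = R ^ 2 * s ^ (-(2 : ℝ)) := by
  have hsq : Real.sqrt s = s ^ (1 / 2 : ℝ) := Real.sqrt_eq_rpow s
  have hsqR : Real.sqrt R = R ^ (1 / 2 : ℝ) := Real.sqrt_eq_rpow R
  refine ⟨?_, ?_, ?_⟩
  · rw [hsqR, div_eq_mul_inv, ← Real.rpow_neg_one R, ← Real.rpow_add hR, hsq, Real.sqrt_eq_rpow,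
      ← Real.rpow_mul hs.le, ← Real.rpow_neg hs.le, ← Real.rpow_neg hs.le, ← Real.rpow_add hs]
    norm_num
  · rw [hsq, mul_inv, ← Real.rpow_neg_one R, ← Real.rpow_neg hs.le]
    norm_num
  · have h4 : Real.sqrt s ^ 4 = s ^ 2 := by
      rw [show (4 : ℕ) = 2 * 2 from rfl, pow_mul, Real.sq_sqrt hs.le]
    rw [h4, Real.rpow_neg hs.le, Real.rpow_two]

/-! ### The five term estimates (pure real algebra; the radial integral enters as a real number `I`) -/

/-- Near term, regime `−t ≤ R²`: `c₁(L₀/√s)/R · W · I ≤ 64 c₁L₀W|B₁| · R^{2·(3/4)−2} s^{−3/4}` once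
`I ≤ (√√s)⁻¹ · 6|B₁| √(4R)`. -/
theorem near_term_one {c₁ L₀ W V₁ R s I : ℝ} (hc₁ : 0 ≤ c₁) (hL₀ : 0 ≤ L₀) (hW : 0 ≤ W) (hV₁ : 0 ≤ V₁)
    (hR : 0 < R) (hs : 0 < s) (hI : I ≤ (Real.sqrt (Real.sqrt s))⁻¹ * (6 * V₁ * Real.sqrt (4 * R))) :
    c₁ * (L₀ / Real.sqrt s) / R * W * I ≤ 64 * c₁ * L₀ * W * V₁ * (R ^ (2 * (3 / 4 : ℝ) - 2) * s ^ (-(3 / 4 : ℝ))) := by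
  obtain ⟨k34, -, -⟩ := kernel_identities hR hs
  have hσ0 : 0 < Real.sqrt s := Real.sqrt_pos.2 hs
  have hRs : 0 < Real.sqrt R := Real.sqrt_pos.2 hR
  have hsq4 : Real.sqrt (4 * R) = 2 * Real.sqrt R := by
    rw [Real.sqrt_mul (by norm_num), show (4 : ℝ) = 2 ^ 2 by norm_num, Real.sqrt_sq (by norm_num)]
  rw [hsq4] at hI
  rw [← k34]
  calc c₁ * (L₀ / Real.sqrt s) / R * W * I
      ≤ c₁ * (L₀ / Real.sqrt s) / R * W * ((Real.sqrt (Real.sqrt s))⁻¹ * (6 * V₁ * (2 * Real.sqrt R))) := by gcongr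
    _ = 12 * (c₁ * L₀ * W * V₁ * (Real.sqrt R / R * ((Real.sqrt s)⁻¹ * (Real.sqrt (Real.sqrt s))⁻¹))) := by
        field_simp
        ring
    _ ≤ 64 * (c₁ * L₀ * W * V₁ * (Real.sqrt R / R * ((Real.sqrt s)⁻¹ * (Real.sqrt (Real.sqrt s))⁻¹))) := by
        have hrest : 0 ≤ c₁ * L₀ * W * V₁ * (Real.sqrt R / R * ((Real.sqrt s)⁻¹ * (Real.sqrt (Real.sqrt s))⁻¹)) := by
          positivity
        nlinarith [hrest]
    _ = _ := by ring

/-- Near term, regime `−t ≥ R²`: `c₁(L₀/√s)/R · W · I ≤ 64 c₁L₀W|B₁| · R² s^{−2}` once `I ≤ (√s)⁻³ (4R)³|B₁|`. -/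
theorem near_term_two {c₁ L₀ W V₁ R s I : ℝ} (hc₁ : 0 ≤ c₁) (hL₀ : 0 ≤ L₀) (hW : 0 ≤ W)
    (hR : 0 < R) (hs : 0 < s) (hI : I ≤ (Real.sqrt s ^ 3)⁻¹ * ((4 * R) ^ 3 * V₁)) :
    c₁ * (L₀ / Real.sqrt s) / R * W * I ≤ 64 * c₁ * L₀ * W * V₁ * (R ^ 2 * s ^ (-(2 : ℝ))) := by
  obtain ⟨-, -, k2⟩ := kernel_identities hR hs
  have hσ0 : 0 < Real.sqrt s := Real.sqrt_pos.2 hs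
  rw [← k2]
  calc c₁ * (L₀ / Real.sqrt s) / R * W * I
      ≤ c₁ * (L₀ / Real.sqrt s) / R * W * ((Real.sqrt s ^ 3)⁻¹ * ((4 * R) ^ 3 * V₁)) := by gcongr
    _ = 64 * c₁ * L₀ * W * V₁ * (R ^ 2 * (Real.sqrt s ^ 4)⁻¹) := by
        field_simp
        ring

/-- Annulus term: `c₂ L₁/(R/2+σ)² · W · ((3R/4+σ)³)⁻¹ · (4R)³|B₁| ≤ (16384/27) c₂L₁W|B₁| · R²((R+σ)⁴)⁻¹`. -/
theorem annulus_term {c₂ L₁ W V₁ R σ : ℝ} (hc₂ : 0 ≤ c₂) (hL₁ : 0 ≤ L₁) (hW : 0 ≤ W) (hV₁ : 0 ≤ V₁)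
    (hR : 0 < R) (hσ : 0 < σ) :
    c₂ * (L₁ / (R / 2 + σ) ^ 2) * W * ((3 * R / 4 + σ) ^ 3)⁻¹ * ((4 * R) ^ 3 * V₁) ≤
      16384 / 27 * c₂ * L₁ * W * V₁ * (R ^ 2 * ((R + σ) ^ 4)⁻¹) := by
  have hRσ : 0 < R + σ := by positivity
  have h64 : 0 ≤ c₂ * L₁ * W * V₁ * 64 := by positivity
  have e1 : ((R / 2 + σ) ^ 2)⁻¹ ≤ 4 * ((R + σ) ^ 2)⁻¹ := by
    rw [show 4 * ((R + σ) ^ 2)⁻¹ = (((R + σ) / 2) ^ 2)⁻¹ by field_simp; ring]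
    exact inv_anti₀ (by positivity) (pow_le_pow_left₀ (by positivity) (by linarith) 2)
  have e2 : ((3 * R / 4 + σ) ^ 3)⁻¹ ≤ 64 / 27 * ((R + σ) ^ 3)⁻¹ := by
    rw [show 64 / 27 * ((R + σ) ^ 3)⁻¹ = ((3 * (R + σ) / 4) ^ 3)⁻¹ by field_simp; ring]
    exact inv_anti₀ (by positivity) (pow_le_pow_left₀ (by positivity) (by linarith) 3)
  have e3 : R ^ 3 * ((R + σ) ^ 5)⁻¹ ≤ R ^ 2 * ((R + σ) ^ 4)⁻¹ := by
    rw [show R ^ 3 * ((R + σ) ^ 5)⁻¹ = R ^ 2 * ((R + σ) ^ 4)⁻¹ * (R / (R + σ)) by field_simp]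
    exact mul_le_of_le_one_right (by positivity) ((div_le_one hRσ).2 (by linarith))
  calc c₂ * (L₁ / (R / 2 + σ) ^ 2) * W * ((3 * R / 4 + σ) ^ 3)⁻¹ * ((4 * R) ^ 3 * V₁)
      = c₂ * L₁ * W * V₁ * 64 * (((R / 2 + σ) ^ 2)⁻¹ * ((3 * R / 4 + σ) ^ 3)⁻¹ * R ^ 3) := by
        field_simp
        ring
    _ ≤ c₂ * L₁ * W * V₁ * 64 * ((4 * ((R + σ) ^ 2)⁻¹) * (64 / 27 * ((R + σ) ^ 3)⁻¹) * R ^ 3) :=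
        mul_le_mul_of_nonneg_left (by gcongr) h64
    _ = 16384 / 27 * c₂ * L₁ * W * V₁ * (R ^ 3 * ((R + σ) ^ 5)⁻¹) := by
        field_simp
        ring
    _ ≤ 16384 / 27 * c₂ * L₁ * W * V₁ * (R ^ 2 * ((R + σ) ^ 4)⁻¹) := by gcongr

/-- Far term, regime `−t ≤ R²`: `(16/π²)(L₀/√s)(2R)³|B₁| · W · I ≤ (96/π²) L₀|B₁|²W · R^{2·(1/2)−2} s^{−1/2}` once
`I ≤ (3/4)|B₁| ((4R)⁴)⁻¹`. -/
theorem far_term_one {L₀ W V₁ R s I : ℝ} (hL₀ : 0 ≤ L₀) (hW : 0 ≤ W) (hV₁ : 0 ≤ V₁) (hR : 0 < R) (hs : 0 < s)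
    (hI : I ≤ 3 * V₁ * ((4 * R) ^ 4)⁻¹ / 4) :
    16 / Real.pi ^ 2 * ((L₀ / Real.sqrt s) * ((2 * R) ^ 3 * V₁)) * W * I ≤
      96 / Real.pi ^ 2 * L₀ * V₁ ^ 2 * W * (R ^ (2 * (1 / 2 : ℝ) - 2) * s ^ (-(1 / 2 : ℝ))) := by
  obtain ⟨-, k12, -⟩ := kernel_identities hR hs
  have hσ0 : 0 < Real.sqrt s := Real.sqrt_pos.2 hs
  rw [← k12]
  calc 16 / Real.pi ^ 2 * ((L₀ / Real.sqrt s) * ((2 * R) ^ 3 * V₁)) * W * I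
      ≤ 16 / Real.pi ^ 2 * ((L₀ / Real.sqrt s) * ((2 * R) ^ 3 * V₁)) * W * (3 * V₁ * ((4 * R) ^ 4)⁻¹ / 4) := by
        gcongr
    _ = 3 / (8 * Real.pi ^ 2) * (L₀ * V₁ ^ 2 * W * (R * Real.sqrt s)⁻¹) := by
        field_simp
        ring
    _ ≤ 96 / Real.pi ^ 2 * (L₀ * V₁ ^ 2 * W * (R * Real.sqrt s)⁻¹) := by
        have hc : 3 / (8 * Real.pi ^ 2) ≤ 96 / Real.pi ^ 2 := by
          rw [div_le_div_iff₀ (by positivity) (by positivity)]; nlinarith [Real.pi_pos, sq_nonneg Real.pi]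
        exact mul_le_mul_of_nonneg_right hc (by positivity)
    _ = _ := by ring

/-- Far term, regime `−t ≥ R²`: `(16/π²)(L₀/√s)(2R)³|B₁| · W · I ≤ (96/π²) L₀|B₁|²W · R² s^{−2}` once
`I ≤ (√s)⁻³ · 3|B₁| (4R)⁻¹`. -/
theorem far_term_two {L₀ W V₁ R s I : ℝ} (hL₀ : 0 ≤ L₀) (hW : 0 ≤ W) (hV₁ : 0 ≤ V₁) (hR : 0 < R) (hs : 0 < s)
    (hI : I ≤ (Real.sqrt s ^ 3)⁻¹ * (3 * V₁ * (4 * R)⁻¹)) :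
    16 / Real.pi ^ 2 * ((L₀ / Real.sqrt s) * ((2 * R) ^ 3 * V₁)) * W * I ≤
      96 / Real.pi ^ 2 * L₀ * V₁ ^ 2 * W * (R ^ 2 * s ^ (-(2 : ℝ))) := by
  obtain ⟨-, -, k2⟩ := kernel_identities hR hs
  have hσ0 : 0 < Real.sqrt s := Real.sqrt_pos.2 hs
  rw [← k2]
  calc 16 / Real.pi ^ 2 * ((L₀ / Real.sqrt s) * ((2 * R) ^ 3 * V₁)) * W * I
      ≤ 16 / Real.pi ^ 2 * ((L₀ / Real.sqrt s) * ((2 * R) ^ 3 * V₁)) * W * ((Real.sqrt s ^ 3)⁻¹ * (3 * V₁ * (4 * R)⁻¹)) := by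
        gcongr
    _ = 96 / Real.pi ^ 2 * L₀ * V₁ ^ 2 * W * (R ^ 2 * (Real.sqrt s ^ 4)⁻¹) := by
        field_simp
        ring

/-! ### The kernel form -/

/-- **The commutator pairing in kernel form.**  For a classical unit-viscosity solution with the scale-invariant
package and the weights `a_R` of an admissible bump there are `c_A, c_B, c_C ≥ 0` with, for all `R > 0`, `t < 0`,
`|∫⟪[Λ,a_R]v(t), ∂ₜv(t)⟫| ≤ c_A·k_{3/4}(t) + c_B·R²((R+√(−t))⁴)⁻¹ + c_C·k_{1/2}(t)`, where
`k_α(t) = R^{2α−2}(−t)^{−α}` for `−t ≤ R²` and `R²(−t)^{−2}` otherwise. -/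
theorem exists_commutatorKernel_bound {η : EuclideanSpace ℝ (Fin 3) → ℝ}
    {v : ℝ → EuclideanSpace ℝ (Fin 3) → EuclideanSpace ℝ (Fin 3)} {q : ℝ → EuclideanSpace ℝ (Fin 3) → ℝ}
    (hη : IsAdmissibleBump η) (hsol : IsClassicalNSSolutionOn (Iio (0 : ℝ)) 1 0 v q) (hSIB : ScaleInvariantBounds v q) :
    ∃ cA cB cC : ℝ, 0 ≤ cA ∧ 0 ≤ cB ∧ 0 ≤ cC ∧ ∀ R > (0 : ℝ), ∀ t < (0 : ℝ),
      |∫ x, ⟪lamComm (bumpSq η R) (v t) x, timeDeriv v t x⟫| ≤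
        cA * (if -t ≤ R ^ 2 then R ^ (2 * (3 / 4 : ℝ) - 2) * (-t) ^ (-(3 / 4 : ℝ)) else R ^ 2 * (-t) ^ (-(2 : ℝ))) +
          cB * (R ^ 2 * ((R + Real.sqrt (-t)) ^ 4)⁻¹) +
          cC * (if -t ≤ R ^ 2 then R ^ (2 * (1 / 2 : ℝ) - 2) * (-t) ^ (-(1 / 2 : ℝ)) else R ^ 2 * (-t) ^ (-(2 : ℝ))) := by
  obtain ⟨c₁, c₂, W, L₀, L₁, hc₁, hc₂, hW, hL₀, hL₁, hpair⟩ := abs_commutatorPairing_le hη hsol hSIB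
  have hV₁0 : 0 ≤ (volume : Measure (EuclideanSpace ℝ (Fin 3))).real (ball 0 1) := measureReal_nonneg
  refine ⟨64 * c₁ * L₀ * W * (volume : Measure (EuclideanSpace ℝ (Fin 3))).real (ball 0 1),
    16384 / 27 * c₂ * L₁ * W * (volume : Measure (EuclideanSpace ℝ (Fin 3))).real (ball 0 1),
    96 / Real.pi ^ 2 * L₀ * (volume : Measure (EuclideanSpace ℝ (Fin 3))).real (ball 0 1) ^ 2 * W,
    by positivity, by positivity, by positivity, fun R hR t ht => ?_⟩
  have hs : 0 < -t := neg_pos.2 ht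
  have hσ0 : 0 < Real.sqrt (-t) := Real.sqrt_pos.2 hs
  have h4R : 0 < 4 * R := by positivity
  have hP := hpair R hR t ht
  have hB := annulus_term hc₂ hL₁ hW hV₁0 hR hσ0
  by_cases hreg : -t ≤ R ^ 2
  · rw [if_pos hreg, if_pos hreg]
    have hA := near_term_one hc₁ hL₀ hW hV₁0 hR hs (radial_near_le_one h4R hσ0)
    have hC := far_term_one hL₀ hW hV₁0 hR hs (radial_far_le_one h4R hσ0).2
    linarith
  · rw [if_neg hreg, if_neg hreg]
    have hA := near_term_two hc₁ hL₀ hW hR hs (radial_near_le_two h4R hσ0)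
    have hC := far_term_two hL₀ hW hV₁0 hR hs (radial_far_le_two h4R hσ0)
    linarith

end Summit.NavierStokesRegularity.NavierStokesRegularity.Theorems.CriticalFluxDoorCommutatorKernel

end
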